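import Summits.CriticalPhenomena.PercolationContinuityZ3.Theorems.PercNearOneGluingNoHeavyQuantGluedLemmaW
import Summits.CriticalPhenomena.PercolationContinuityZ3.Theorems.PercNearOneGluingNoHeavyQuantGluedDominationGuarded
import HarnessLib

/-!
# QUANT lane R8, T-DEC: the SINGLE-LAYER ASSEMBLY for the glued-piece slice — given LEMMA W, the pullback `Ψ` of every certificate is itself a price system
# of the first factor at the layer `J = max(j − r − k, largest cheap atom)`; hence `GluedLemmaW ⟹ GluedDominated'` at the trivial gate `a = 1`, and at
# `a < 1` modulo the zero's pair conditions at that layer (arm-1 gen 58, architect)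

builds on p205010 (kernel theorem, internal audit signed; external expert review pending)

Support file (`--supports stmt-CriticalPhenomena-4575`), QUANT lane seat prim-quant-arm-1 (gen 58, architect); memo
`run/shared/lean/prim/quant/prim-quant-arm-1-g58/ARCH-G58.md` §2.  Theorems only; standard axioms, no sorries, no definitions.

THE ASSEMBLY (memo §2; census-2 g55's `sliceSingleLayer_of_midLemmas` transplanted).  Band frame of `GluedDominated'`; a certificate `(α, p)` of
`ν_a = gate_a(β ∗ t)` at `(y = ax, T = a(S+m), j)`; `Ψ = gluedPullback T q g j r k α p`.  Let `l*` maximise `Ψ` over the lows `l ≤ min(j,B)`, `2l < T₀ = aS`,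
call `h` CHEAP if `−Ψ(h)·y < (1−y)·Ψ(l*)`, and let `J = max(j − r − k, largest cheap atom ≤ min(j,B))` (`gluedLayer_exists`).  Then (`gluedCertificate_of_lemmaW`):
* `β′ := −Ψ` on the `J`-non-lows `≤ B` is `≥ 0` — THE ABSORBER HALF `gluedPullback_nonpos` (every `h > J ≥ j−r−k` is a window atom, every other non-low has `2h ≥ T₀`);
* giants `v > j`: `gluedPullback_giant_usage`; giants `J < v ≤ j`: NOT cheap, so `Ψ(l) ≤ Ψ(l*) ≤ y/(1−y)·(−Ψ(v))`;
* mids with a HEAVY minimal gate: `gluedPullback_heavyPair_usage`; DEEP mids (`v + r + k ≤ j`): `gluedPullback_deepPair_usage` (no-giant closure);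
* LIGHT WINDOW mids `j − r − k < v ≤ J`: then `J` is cheap, and LEMMA W (`gluedPullback_windowPair_usage_of_lemmaW`, `c = J`);
* rows: equality (`α′ := Ψ` on lows, except `α′(0) := max(e(0), Ψ(0))` when `a < 1`); tilt `λ = 0`; the gate row from `α′(0) ≥ e(0)` — which needs the ZERO'S
  PAIR CONDITIONS `e(0) ≤ usage(0,v)·(−Ψ(v))` at `J` as a hypothesis when `a < 1` (memo §5: true except in rare small cases, where only a tilt certifies).
* **`gluedDominated_one_of_lemmaW`**: at `a = 1` nothing is left — `GluedLemmaW →` the conclusion of `GluedDominated'` for every certificate at the trivial gate.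
So the law-level R8 node's band is, at `a = 1`, EXACTLY LEMMA W; for `a < 1` the gate row remains (memo §5).

HONEST STATUS.  `GluedLemmaW`, `GluedDominated'`, the band, `SiblingStep`, `FarTreeRow` OPEN; RATE class (log\*) / honest sentence unchanged.  [this work].  Nothing here
is cited as a published result.  The gluing rows served [cite: KozmaNitzan2024, Conjecture 3 (p. 15)]; product measure [cite: Grimmett1999, §1.3 p. 10].
-/

noncomputable section

open scoped BigOperators

namespace Summit.CriticalPhenomena.PercolationContinuityZ3.Theorems
namespace Quant

open Finset

namespace LawDec

/-! ### The layer of the rule exists -/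

/-- **the rule's data exist**: for any function `Ψ` and `0 < T₀`, there are a maximiser `l*` of `Ψ` over the lows `l ≤ min(j,B)`, `2l < T₀`, and a layer
`J ≤ min(j, B)` with `j ≤ J + (r+k)` such that every atom `J < h ≤ min(j,B)` is NOT cheap and, if some atom `1 ≤ v ≤ J` lies in the window `j < v + r + k`,
`J` itself is cheap (`J = max(j − r − k, largest cheap atom)`). [this work] -/
theorem gluedLayer_exists (Ψ : ℕ → ℝ) (y T₀ : ℝ) (j B r k : ℕ) (hT₀ : 0 < T₀) (hjM : j < B + (r + k)) :
    ∃ ls J : ℕ, ls ≤ B ∧ ls ≤ j ∧ 2 * (ls : ℝ) < T₀ ∧ (∀ l, l ≤ B → l ≤ j → 2 * (l : ℝ) < T₀ → Ψ l ≤ Ψ ls) ∧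
      j ≤ J + (r + k) ∧ J ≤ B ∧ J ≤ j ∧
      (∀ h, J < h → h ≤ B → h ≤ j → (1 - y) * Ψ ls ≤ (-Ψ h) * y) ∧
      (∀ v, 1 ≤ v → v ≤ J → j < v + r + k → (-Ψ J) * y < (1 - y) * Ψ ls) := by
  classical
  -- the maximiser
  set L : Finset ℕ := (Finset.range (min j B + 1)).filter (fun l => 2 * (l : ℝ) < T₀) with hL
  have hLmem : ∀ l, l ∈ L ↔ (l ≤ B ∧ l ≤ j) ∧ 2 * (l : ℝ) < T₀ := by
    intro l
    rw [hL, Finset.mem_filter, Finset.mem_range, Nat.lt_succ_iff, le_min_iff]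
    tauto
  have hLne : L.Nonempty := ⟨0, (hLmem 0).2 ⟨⟨Nat.zero_le _, Nat.zero_le _⟩, by simpa using hT₀⟩⟩
  obtain ⟨ls, hlsL, hlsmax⟩ := Finset.exists_max_image L Ψ hLne
  obtain ⟨⟨hlsB, hlsj⟩, hlsT⟩ := (hLmem ls).1 hlsL
  -- the cheap atoms and the layer
  set C : Finset ℕ := (Finset.range (min j B + 1)).filter (fun h => (-Ψ h) * y < (1 - y) * Ψ ls) with hC
  have hCmem : ∀ h, h ∈ C ↔ (h ≤ B ∧ h ≤ j) ∧ (-Ψ h) * y < (1 - y) * Ψ ls := by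
    intro h
    rw [hC, Finset.mem_filter, Finset.mem_range, Nat.lt_succ_iff, le_min_iff]
    tauto
  let hc : ℕ := if hCne : C.Nonempty then C.max' hCne else 0
  have hhc : hc ≤ B ∧ hc ≤ j := by
    by_cases hCne : C.Nonempty
    · have e : hc = C.max' hCne := by simp only [hc, dif_pos hCne]
      rw [e]; exact ((hCmem _).1 (Finset.max'_mem C hCne)).1
    · have e : hc = 0 := by simp only [hc, dif_neg hCne]
      rw [e]; exact ⟨Nat.zero_le _, Nat.zero_le _⟩
  refine ⟨ls, max (j - (r + k)) hc, hlsB, hlsj, hlsT, fun l hlB hlj hlT => hlsmax l ((hLmem l).2 ⟨⟨hlB, hlj⟩, hlT⟩), ?_, ?_, ?_, ?_, ?_⟩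
  · omega
  · exact max_le (by omega) hhc.1
  · exact max_le (by omega) hhc.2
  · intro h h1 h2 h3
    by_contra hlt
    have hmem : h ∈ C := (hCmem h).2 ⟨⟨h2, h3⟩, not_le.1 hlt⟩
    have hCne : C.Nonempty := ⟨h, hmem⟩
    have e : hc = C.max' hCne := by simp only [hc, dif_pos hCne]
    have hle : h ≤ hc := by rw [e]; exact Finset.le_max' C h hmem
    have := le_max_right (j - (r + k)) hc
    omega
  · intro v h1 h2 h3
    by_cases hCne : C.Nonempty
    · have e : hc = C.max' hCne := by simp only [hc, dif_pos hCne]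
      have hmax : max (j - (r + k)) hc = hc := by
        refine max_eq_right ?_
        by_contra hlt
        have : max (j - (r + k)) hc = j - (r + k) := max_eq_left (not_le.1 hlt).le
        omega
      rw [hmax, e]
      exact ((hCmem _).1 (Finset.max'_mem C hCne)).2
    · have e : hc = 0 := by simp only [hc, dif_neg hCne]
      exfalso
      rw [e] at h2
      have : max (j - (r + k)) 0 = j - (r + k) := max_eq_left (Nat.zero_le _)
      omega

/-! ### The certificate at the rule's layer -/

/-- **THE SINGLE-LAYER CERTIFICATE, GIVEN LEMMA W** (and, for `a < 1`, the zero's pair conditions at the layer).  Band frame of `GluedDominated'`; a price system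
`(α, p)` of the positions at `(ax, a(S+m), j)`; the rule's data `l*`, `J` (as produced by `gluedLayer_exists` for `Ψ = gluedPullback …`).  Conclusion: the
conclusion of `GluedDominated'` at this `J` with `λ = 0`, `β′ = −Ψ` on the non-lows, `α′ = Ψ` (`α′(0) = max(e(0), Ψ(0))` when `a < 1`). [this work] -/
theorem gluedCertificate_of_lemmaW (hW : GluedLemmaW) (x a q g S : ℝ) (B r k j : ℕ) (α p : ℕ → ℝ)
    (hx0 : 0 < x) (hx1 : x < 1) (ha0 : 0 < a) (ha1 : a ≤ 1) (hq0 : 0 < q) (hq1 : q < 1) (hg0 : 0 ≤ g) (hg1 : g ≤ 1) (hr : 1 ≤ r) (hk : 1 ≤ k)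
    (hxqg : x ≤ q * g) (hband1 : 2 * (r : ℝ) < q * ((r : ℝ) + k * g)) (hband2 : q * ((r : ℝ) + k * g) - r < (k : ℝ) * x)
    (hB1 : 1 ≤ B) (hSB1 : x * (B : ℝ) ≤ S) (hSB2 : S ≤ (B : ℝ)) (hjM : j < B + (r + k))
    (hp : ∀ h, 0 ≤ p h)
    (hαp : ∀ l h, l ≤ j → 2 * (l : ℝ) < a * (S + q * ((r : ℝ) + k * g)) → h ≤ B + (r + k) →
      (j + 1 ≤ h ∨ a * (S + q * ((r : ℝ) + k * g)) < (l : ℝ) + h) →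
      α l ≤ usage (a * x) (a * (S + q * ((r : ℝ) + k * g))) j l h * p h)
    (ls J : ℕ) (hlsB : ls ≤ B) (hlsj : ls ≤ j) (hlsT : 2 * (ls : ℝ) < a * S)
    (hmax : ∀ l, l ≤ B → l ≤ j → 2 * (l : ℝ) < a * S →
      gluedPullback (a * (S + q * ((r : ℝ) + k * g))) q g j r k α p l ≤ gluedPullback (a * (S + q * ((r : ℝ) + k * g))) q g j r k α p ls)
    (hJ1 : j ≤ J + (r + k)) (hJB : J ≤ B) (hJj : J ≤ j)
    (hnc : ∀ h, J < h → h ≤ B → h ≤ j →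
      (1 - a * x) * gluedPullback (a * (S + q * ((r : ℝ) + k * g))) q g j r k α p ls
        ≤ (-gluedPullback (a * (S + q * ((r : ℝ) + k * g))) q g j r k α p h) * (a * x))
    (hJc : ∀ v, 1 ≤ v → v ≤ J → j < v + r + k →
      (-gluedPullback (a * (S + q * ((r : ℝ) + k * g))) q g j r k α p J) * (a * x)
        < (1 - a * x) * gluedPullback (a * (S + q * ((r : ℝ) + k * g))) q g j r k α p ls)
    (hgate : a < 1 → ∀ v, v ≤ B → (J + 1 ≤ v ∨ a * S < (v : ℝ)) →
      coefAt (a * (S + q * ((r : ℝ) + k * g))) j α p 0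
        ≤ usage (a * x) (a * S) J 0 v * (-gluedPullback (a * (S + q * ((r : ℝ) + k * g))) q g j r k α p v)) :
    ∃ (α' β' : ℕ → ℝ) (lam : ℝ), (∀ h, 0 ≤ β' h) ∧
      (∀ l h, l ≤ J → 2 * (l : ℝ) < a * S → h ≤ B → (J + 1 ≤ h ∨ a * S < (l : ℝ) + h) →
        α' l ≤ usage (a * x) (a * S) J l h * β' h) ∧
      (∀ h, h ≤ B → gluedPullback (a * (S + q * ((r : ℝ) + k * g))) q g j r k α p h
        ≤ coefAt (a * S) J α' β' h + lam * ((h : ℝ) - S)) ∧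
      (1 - a) * coefAt (a * (S + q * ((r : ℝ) + k * g))) j α p 0 ≤ (1 - a) * coefAt (a * S) J α' β' 0 := by
  classical
  set y : ℝ := a * x with hy
  set T : ℝ := a * (S + q * ((r : ℝ) + k * g)) with hT
  set T₀ : ℝ := a * S with hT₀
  set m : ℝ := q * ((r : ℝ) + k * g) with hm
  set Ψ : ℕ → ℝ := gluedPullback T q g j r k α p with hΨ
  set e0 : ℝ := coefAt T j α p 0 with he0
  have hy0 : 0 < y := mul_pos ha0 hx0
  have hy1 : y < 1 := by rw [hy]; nlinarith
  have hk0 : (0 : ℝ) ≤ k := Nat.cast_nonneg k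
  have hr0 : (0 : ℝ) ≤ r := Nat.cast_nonneg r
  have hm0 : 0 < m := by rw [hm]; nlinarith
  have hyqg : y ≤ q * g := le_trans (by rw [hy]; nlinarith) hxqg
  have haff : y * ((r : ℝ) + k) ≤ m := by
    have h1 : x * ((r : ℝ) + k) ≤ q * g * ((r : ℝ) + k) := mul_le_mul_of_nonneg_right hxqg (by linarith)
    have h2 : q * g * ((r : ℝ) + k) ≤ m := by rw [hm]; nlinarith [mul_nonneg hq0.le hr0]
    have h3 : y * ((r : ℝ) + k) ≤ x * ((r : ℝ) + k) := mul_le_mul_of_nonneg_right (by rw [hy]; nlinarith) (by linarith)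
    linarith
  have hTT : T ≤ T₀ + m := by rw [hT, hT₀]; nlinarith
  have hTeq : T = T₀ + a * m := by rw [hT, hT₀, hm]; ring
  have hB1' : (1 : ℝ) ≤ (B : ℝ) := by exact_mod_cast hB1
  have hS0 : 0 < S := lt_of_lt_of_le (by nlinarith) hSB1
  have hT₀0 : 0 < T₀ := mul_pos ha0 hS0
  -- the certificate
  obtain ⟨β', hβ'eq⟩ : ∃ f : ℕ → ℝ, ∀ v, f v = if v ≤ B ∧ ¬ (v ≤ J ∧ 2 * (v : ℝ) < T₀) then -Ψ v else 0 := ⟨_, fun v => rfl⟩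
  obtain ⟨α', hα'eq⟩ : ∃ f : ℕ → ℝ, ∀ l, f l = if l = 0 ∧ a < 1 then max e0 (Ψ 0) else Ψ l := ⟨_, fun l => rfl⟩
  -- (O1) nonnegativity of β′ = the absorber half
  have hβ' : ∀ v, 0 ≤ β' v := by
    intro v
    by_cases hc : v ≤ B ∧ ¬ (v ≤ J ∧ 2 * (v : ℝ) < T₀)
    · have e : β' v = -Ψ v := by rw [hβ'eq v, if_pos hc]
      rw [e]
      have habs : T ≤ 2 * (v : ℝ) + m ∨ j < v + r + k := by
        by_cases hvJ : v ≤ J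
        · have h2 : ¬ 2 * (v : ℝ) < T₀ := fun h2 => hc.2 ⟨hvJ, h2⟩
          left; linarith [not_lt.1 h2]
        · right; omega
      have := gluedPullback_nonpos y q g T r k j B v α p hy0 hy1 hq0 hq1.le hg0 hg1 hr hyqg haff hjM hc.1 habs hp hαp
      linarith
    · have e : β' v = 0 := by rw [hβ'eq v, if_neg hc]
      rw [e]
  -- the core: Ψ(l) ≤ usage·(−Ψ v) for every J-low l and compatible v ≤ B
  have core : ∀ l v, l ≤ J → 2 * (l : ℝ) < T₀ → v ≤ B → (J + 1 ≤ v ∨ T₀ < (l : ℝ) + v) →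
      Ψ l ≤ usage y T₀ J l v * (-Ψ v) := by
    intro l v hlJ hlT hvB hcomp
    have hlB : l ≤ B := hlJ.trans hJB
    have hlj : l ≤ j := hlJ.trans hJj
    rcases hcomp with hgi | hmid
    · -- v is a giant at layer J
      by_cases hvj : j < v
      · exact gluedPullback_giant_usage y q g T T₀ r k j B l v J α p hy0 hy1 hq0 hq1.le hg0 hg1 hr hjM hlB hvB hvj hgi hp hαp
      · -- J < v ≤ j: not cheap
        have hvj' : v ≤ j := not_lt.1 hvj
        have h1 := hnc v (by omega) hvB hvj'
        have h2 := hmax l hlB hlj hlT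
        rw [usage_giant_eq y T₀ J l v hgi]
        have h1y : 0 < 1 - y := by linarith
        rw [div_mul_eq_mul_div, le_div_iff₀ h1y]
        calc Ψ l * (1 - y) ≤ Ψ ls * (1 - y) := mul_le_mul_of_nonneg_right h2 h1y.le
          _ ≤ y * -Ψ v := by linarith
    · -- v is a mid: l < v ≤ J
      have hlv : (l : ℝ) < v := by linarith
      have hlv' : l < v := by exact_mod_cast hlv
      by_cases hgi : J + 1 ≤ v
      · -- (cannot be: then also a giant — handled as giant)
        by_cases hvj : j < v
        · exact gluedPullback_giant_usage y q g T T₀ r k j B l v J α p hy0 hy1 hq0 hq1.le hg0 hg1 hr hjM hlB hvB hvj hgi hp hαp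
        · have hvj' : v ≤ j := not_lt.1 hvj
          have h1 := hnc v (by omega) hvB hvj'
          have h2 := hmax l hlB hlj hlT
          rw [usage_giant_eq y T₀ J l v hgi]
          have h1y : 0 < 1 - y := by linarith
          rw [div_mul_eq_mul_div, le_div_iff₀ h1y]
          calc Ψ l * (1 - y) ≤ Ψ ls * (1 - y) := mul_le_mul_of_nonneg_right h2 h1y.le
            _ ≤ y * -Ψ v := by linarith
      have hvJ : v ≤ J := by omega
      by_cases hheavy : y ≤ pairGate y T₀ l v
      · exact gluedPullback_heavyPair_usage y q g T T₀ r k j B l v J α p hy0 hy1 hq0 hq1.le hg0 hg1 hr hyqg haff hjM hTT hlv' hlj hvB hvJ hlT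
          hmid hheavy hp hαp
      · have hlight : pairGate y T₀ l v < y := not_le.1 hheavy
        by_cases hdeep : v + r + k ≤ j
        · exact gluedPullback_deepPair_usage y q g T T₀ r k j B l v J α p hy0 hy1 hq0 hq1.le hg0 hg1 hr hyqg haff hjM hTT hlv' hdeep hvB hvJ
            hlT hmid hp hαp
        · -- a light WINDOW pair below J: J is cheap, LEMMA W with c = J
          have hwin : j < v + r + k := by omega
          have hv1 : 1 ≤ v := by omega
          have hcheap := hJc v hv1 hvJ hwin
          exact gluedPullback_windowPair_usage_of_lemmaW hW x a q g S B r k j l v J ls J α p hx0 hx1 ha0 ha1 hq0 hq1 hg0 hg1 hr hk hxqg hband1 hband2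
            hSB1 hSB2 hjM hlv' hvB (hvJ.trans hJj) hwin hlT hmid hlight hvJ hvJ hJB hJj hlsB hlsj hlsT hp hαp hcheap
  refine ⟨α', β', 0, hβ', ?_, ?_, ?_⟩
  · -- (O2) pair conditions
    intro l v hlJ hlT hvB hcomp
    have hvnl : v ≤ B ∧ ¬ (v ≤ J ∧ 2 * (v : ℝ) < T₀) := by
      refine ⟨hvB, fun hc => ?_⟩
      rcases hcomp with h1 | h2
      · omega
      · linarith [hc.2]
    have eβ : β' v = -Ψ v := by rw [hβ'eq v, if_pos hvnl]
    rw [eβ]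
    have hc := core l v hlJ hlT hvB hcomp
    by_cases h0 : l = 0 ∧ a < 1
    · have eα : α' l = max e0 (Ψ 0) := by rw [hα'eq l, if_pos h0]
      rw [eα]
      obtain ⟨hl0, ha⟩ := h0
      subst hl0
      refine max_le ?_ hc
      have hcomp' : J + 1 ≤ v ∨ a * S < (v : ℝ) := by
        rcases hcomp with h1 | h2
        · exact Or.inl h1
        · right; simpa using h2
      exact hgate ha v hvB hcomp'
    · have eα : α' l = Ψ l := by rw [hα'eq l, if_neg h0]
      rw [eα]; exact hc
  · -- (O3) the rows hold with equality (up to the max at zero)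
    intro h hhB
    rw [zero_mul, add_zero]
    unfold coefAt
    by_cases hlow : h ≤ J ∧ 2 * (h : ℝ) < T₀
    · rw [if_pos hlow]
      by_cases h0 : h = 0 ∧ a < 1
      · have eα : α' h = max e0 (Ψ 0) := by rw [hα'eq h, if_pos h0]
        rw [eα, h0.1]; exact le_max_right _ _
      · have eα : α' h = Ψ h := by rw [hα'eq h, if_neg h0]
        rw [eα]
    · rw [if_neg hlow]
      have eβ : β' h = -Ψ h := by rw [hβ'eq h, if_pos ⟨hhB, hlow⟩]
      rw [eβ, neg_neg]
  · -- (O4) the gate row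
    have hlow0 : 0 ≤ J ∧ 2 * ((0 : ℕ) : ℝ) < T₀ := ⟨Nat.zero_le _, by simpa using hT₀0⟩
    unfold coefAt
    rw [if_pos hlow0]
    rcases ha1.lt_or_eq with ha | ha
    · have eα : α' 0 = max e0 (Ψ 0) := by rw [hα'eq 0, if_pos ⟨rfl, ha⟩]
      rw [eα]
      exact mul_le_mul_of_nonneg_left (le_max_left _ _) (by linarith)
    · rw [ha, sub_self, zero_mul, zero_mul]

/-! ### The trivial gate: LEMMA W is everything -/

/-- **`GluedLemmaW` ⟹ THE CONCLUSION OF `GluedDominated'` AT THE TRIVIAL GATE `a = 1`** (no gate row): for every band instance (`1 ≤ B`) and every price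
system of the positions at `(x, S + m, j)`, the single-layer certificate exists. [this work] -/
theorem gluedDominated_one_of_lemmaW (hW : GluedLemmaW) (x q g S : ℝ) (B r k j : ℕ) (α p : ℕ → ℝ)
    (hx0 : 0 < x) (hx1 : x < 1) (hq0 : 0 < q) (hq1 : q < 1) (hg0 : 0 ≤ g) (hg1 : g ≤ 1) (hr : 1 ≤ r) (hk : 1 ≤ k)
    (hxqg : x ≤ q * g) (hband1 : 2 * (r : ℝ) < q * ((r : ℝ) + k * g)) (hband2 : q * ((r : ℝ) + k * g) - r < (k : ℝ) * x)
    (hB1 : 1 ≤ B) (hSB1 : x * (B : ℝ) ≤ S) (hSB2 : S ≤ (B : ℝ)) (hjM : j < B + (r + k))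
    (hp : ∀ h, 0 ≤ p h)
    (hαp : ∀ l h, l ≤ j → 2 * (l : ℝ) < 1 * (S + q * ((r : ℝ) + k * g)) → h ≤ B + (r + k) →
      (j + 1 ≤ h ∨ 1 * (S + q * ((r : ℝ) + k * g)) < (l : ℝ) + h) →
      α l ≤ usage (1 * x) (1 * (S + q * ((r : ℝ) + k * g))) j l h * p h) :
    ∃ (J : ℕ) (α' β' : ℕ → ℝ) (lam : ℝ), J ≤ B ∧ (∀ h, 0 ≤ β' h) ∧
      (∀ l h, l ≤ J → 2 * (l : ℝ) < 1 * S → h ≤ B → (J + 1 ≤ h ∨ 1 * S < (l : ℝ) + h) →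
        α' l ≤ usage (1 * x) (1 * S) J l h * β' h) ∧
      (∀ h, h ≤ B → gluedPullback (1 * (S + q * ((r : ℝ) + k * g))) q g j r k α p h
        ≤ coefAt (1 * S) J α' β' h + lam * ((h : ℝ) - S)) ∧
      (1 - (1 : ℝ)) * coefAt (1 * (S + q * ((r : ℝ) + k * g))) j α p 0 ≤ (1 - (1 : ℝ)) * coefAt (1 * S) J α' β' 0 := by
  have hB1' : (1 : ℝ) ≤ (B : ℝ) := by exact_mod_cast hB1
  have hS0 : 0 < S := lt_of_lt_of_le (by nlinarith) hSB1
  obtain ⟨ls, J, hlsB, hlsj, hlsT, hmax, hJ1, hJB, hJj, hnc, hJc⟩ :=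
    gluedLayer_exists (gluedPullback (1 * (S + q * ((r : ℝ) + k * g))) q g j r k α p) (1 * x) (1 * S) j B r k (by linarith) hjM
  obtain ⟨α', β', lam, hβ', hpairs, hrows, hgate⟩ :=
    gluedCertificate_of_lemmaW hW x 1 q g S B r k j α p hx0 hx1 one_pos le_rfl hq0 hq1 hg0 hg1 hr hk hxqg hband1 hband2 hB1 hSB1 hSB2 hjM hp hαp
      ls J hlsB hlsj hlsT hmax hJ1 hJB hJj hnc hJc (fun ha => absurd ha (lt_irrefl _))
  exact ⟨J, α', β', lam, hJB, hβ', hpairs, hrows, hgate⟩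

end LawDec
end Quant
end Summit.CriticalPhenomena.PercolationContinuityZ3.Theorems
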